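import Mathlib.RingTheory.RootsOfUnity.AlgebraicallyClosed
import Mathlib.RingTheory.IntegralDomain
import Mathlib.FieldTheory.IsAlgClosed.Basic
import Mathlib.Data.ZMod.Units
import HarnessLib

/-!
# Transport of roots of unity along two rigid evaluations `R → Ω₀`, `R → Ω₁`

Layer `Literature/GroupTheory/FiniteAbelian`, namespace `Literature.GroupTheory.FiniteAbelian`.
THEOREMS ONLY (no definition, no named fact, no instance, no `sorry`).

Setting (the algebra of [Lan2013PELCompactifications] Lemma 1.3.6.6's transport of symplectic-liftability between two geometric
points of a connected base, cell hodgecm-mathlib (h9-S) (W3-alg)): a commutative ring `R` (the global functions of a connected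
finite étale cover `S′₀`), two ring homomorphisms `ev₀ : R → Ω₀`, `ev₁ : R → Ω₁` into algebraically closed fields with `M`
invertible (evaluations at two geometric points), which are RIGID on `M`-th roots of unity: `u^M = 1 ∧ evᵢ u = 1 ⇒ u = 1`
(★ `Morphisms/RootOfUnityRigidConnected`).  Then the `M`-th roots of unity of `R` form a finite CYCLIC group embedded in both
`μ_M(Ω₀)` and `μ_M(Ω₁)` ([Serre1973] Ch. I §1.2: a finite subgroup of the multiplicative group of a field is cyclic; Mathlib
`isCyclic_of_injective_ringHom`), and the partial bijection `ev₀ u ↦ ev₁ u` EXTENDS to a map `χ : Ω₀ → Ω₁` which is an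
isomorphism of `μ_M(Ω₀)` onto `μ_M(Ω₁)` in the elementary sense used by the consumer: `χ` sends primitive `M`-th roots to primitive
`M`-th roots and `χ(z^e) = χ(z)^e` on `μ_M(Ω₀)`.

* `exists_coprime_mul_modEq` — `gcd(a, M) = gcd(c, M) ⇒ ∃ b` coprime to `M` with `b·a ≡ c (mod M)` (units of `ℤ/(M/m)` lift to
  units of `ℤ/M`, Mathlib `ZMod.unitsMap_surjective`);
* `exists_isPrimitiveRoot_pow_eq_of_orderOf_eq` — in a field with a primitive `M`-th root, every `h` with `h^M = 1` and
  `orderOf h = orderOf (ω^a)` is `ω₁^a` for some PRIMITIVE `ω₁`;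
* **`exists_rootsOfUnity_transport`** — THE HEAD described above.

Cell hodgecm-mathlib (D-0151), F-DAG (h9) symplectic half, (W3-alg) (census `B-provers/B-p13/g18/CENSUS-h9S-W2-FibreIdentification` §3).
Count-neutral; HC_CM is proved only modulo the 7 printed citations until rung 0 closes — nothing here is about HC.

## References
* [Lan2013PELCompactifications] K.-W. Lan, *Arithmetic compactifications of PEL-type Shimura varieties* (2013), §1.3.6 Lemma 1.3.6.6
  and Cor. 1.3.6.7 (pp. 81–82).
* [Serre1973] J.-P. Serre, *A Course in Arithmetic* (1973), Ch. I §1.2 Thm. 2 (and its Lemma): finite subgroups of `K^×` are cyclic.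
-/

set_option autoImplicit false

namespace Literature.GroupTheory.FiniteAbelian

/-! ## §1 Number theory: solving `b·a ≡ c (mod M)` with `b` a unit -/

/-- **`gcd(a, M) = gcd(c, M) ⇒ b·a ≡ c (mod M)` for some `b` coprime to `M`** (`M ≠ 0`): write `a = m a′`, `c = m c′`, `M = m M′`
with `a′, c′` units mod `M′`, lift the unit `c′ a′⁻¹ ∈ (ℤ/M′)^×` to `(ℤ/M)^×` (Mathlib `ZMod.unitsMap_surjective`).
[cite: Serre1973, Ch. I §1.2 Thm. 2] -/
theorem exists_coprime_mul_modEq {M a c : ℕ} (hM : M ≠ 0) (h : Nat.gcd a M = Nat.gcd c M) :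
    ∃ b : ℕ, Nat.Coprime b M ∧ b * a ≡ c [MOD M] := by
  obtain ⟨a', ha'⟩ : Nat.gcd a M ∣ a := Nat.gcd_dvd_left a M
  obtain ⟨M', hM'⟩ : Nat.gcd a M ∣ M := Nat.gcd_dvd_right a M
  obtain ⟨c', hc'⟩ : Nat.gcd a M ∣ c := h ▸ Nat.gcd_dvd_left c M
  have hm0 : Nat.gcd a M ≠ 0 := fun h0 => hM (Nat.eq_zero_of_gcd_eq_zero_right h0)
  have hmpos : 0 < Nat.gcd a M := Nat.pos_of_ne_zero hm0
  have hM'0 : M' ≠ 0 := fun h0 => hM (by rw [hM', h0, mul_zero])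
  haveI : NeZero M' := ⟨hM'0⟩
  haveI : NeZero M := ⟨hM⟩
  -- `a′`, `c′` are coprime to `M′`
  have hcopa : Nat.Coprime a' M' := by
    have hg := Nat.gcd_mul_left (Nat.gcd a M) a' M'
    rw [← ha', ← hM'] at hg
    exact Nat.eq_of_mul_eq_mul_left hmpos ((mul_one _).trans hg).symm
  have hcopc : Nat.Coprime c' M' := by
    have hg := Nat.gcd_mul_left (Nat.gcd a M) c' M'
    rw [← hc', ← hM', ← h] at hg
    exact Nat.eq_of_mul_eq_mul_left hmpos ((mul_one _).trans hg).symm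
  have hdvd : M' ∣ M := Dvd.intro_left _ hM'.symm
  obtain ⟨y, hy⟩ := ZMod.unitsMap_surjective hdvd (ZMod.unitOfCoprime c' hcopc * (ZMod.unitOfCoprime a' hcopa)⁻¹)
  refine ⟨(y : ZMod M).val, ZMod.val_coe_unit_coprime y, ?_⟩
  -- `(y mod M′) · a′ = c′` in `ℤ/M′`
  have hy' : (ZMod.castHom hdvd (ZMod M')) (y : ZMod M) * (a' : ZMod M') = (c' : ZMod M') := by
    have hv := congrArg (fun u : (ZMod M')ˣ => (u : ZMod M')) hy
    simp only [ZMod.unitsMap_def, Units.coe_map, MonoidHom.coe_coe, Units.val_mul, ZMod.coe_unitOfCoprime] at hv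
    rw [hv, mul_assoc, ← ZMod.coe_unitOfCoprime a' hcopa, Units.inv_mul, mul_one]
  rw [ZMod.castHom_apply, ZMod.cast_eq_val, ← Nat.cast_mul, ZMod.natCast_eq_natCast_iff] at hy'
  -- multiply the congruence by `m`
  have hfin := Nat.ModEq.mul_right' (Nat.gcd a M) hy'
  rw [mul_assoc, mul_comm a', ← ha', mul_comm c', ← hc', mul_comm M', ← hM'] at hfin
  exact hfin

/-! ## §2 Primitive roots with a prescribed power -/

/-- `orderOf (x^n) = orderOf x / gcd (orderOf x) n` for `x` of finite order (also at `n = 0`). [cite: Serre1973, Ch. I §1.2 Thm. 2] -/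
theorem orderOf_pow_eq_div {G : Type*} [Monoid G] (x : G) (hx : 0 < orderOf x) (n : ℕ) :
    orderOf (x ^ n) = orderOf x / (orderOf x).gcd n := by
  rcases Nat.eq_zero_or_pos n with rfl | hn
  · rw [pow_zero, orderOf_one, Nat.gcd_zero_right, Nat.div_self hx]
  · exact orderOf_pow' x (Nat.pos_iff_ne_zero.1 hn)

/-- **In a domain with a primitive `M`-th root `γ`, an `M`-th root of unity `h` whose order is that of `ω^a` (for SOME primitive
`ω` in SOME domain) is `ω₁^a` for a PRIMITIVE `ω₁`**: `h = γ^c` with `gcd(c, M) = gcd(a, M)`, and `γ^{b}` with `b a ≡ c`, `b` a unit,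
does it. [cite: Serre1973, Ch. I §1.2 Thm. 2] -/
theorem exists_isPrimitiveRoot_pow_eq_of_orderOf_eq {Ω Ω' : Type*} [CommRing Ω] [IsDomain Ω] [CommRing Ω'] [IsDomain Ω']
    {M : ℕ} [NeZero M] {γ : Ω} (hγ : IsPrimitiveRoot γ M) {ω : Ω'} (hω : IsPrimitiveRoot ω M) (a : ℕ) {h : Ω}
    (hh : h ^ M = 1) (hord : orderOf h = orderOf (ω ^ a)) :
    ∃ ω₁ : Ω, IsPrimitiveRoot ω₁ M ∧ ω₁ ^ a = h := by
  have hM : M ≠ 0 := NeZero.ne M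
  have hMpos : 0 < M := Nat.pos_of_ne_zero hM
  obtain ⟨c, -, hc⟩ := hγ.eq_pow_of_pow_eq_one hh
  -- `gcd(a, M) = gcd(c, M)` from the orders
  have hoa : orderOf (ω ^ a) = M / Nat.gcd M a := by
    rw [orderOf_pow_eq_div ω (by rw [← hω.eq_orderOf]; exact hMpos), ← hω.eq_orderOf]
  have hoc : orderOf (γ ^ c) = M / Nat.gcd M c := by
    rw [orderOf_pow_eq_div γ (by rw [← hγ.eq_orderOf]; exact hMpos), ← hγ.eq_orderOf]
  have hgcd : Nat.gcd a M = Nat.gcd c M := by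
    have h1 : M / Nat.gcd M a = M / Nat.gcd M c := by rw [← hoa, ← hord, ← hc, hoc]
    rw [Nat.gcd_comm a, Nat.gcd_comm c]
    exact (Nat.div_eq_iff_eq_of_dvd_dvd hM (Nat.gcd_dvd_left M a) (Nat.gcd_dvd_left M c)).1 h1
  obtain ⟨b, hb, hbac⟩ := exists_coprime_mul_modEq hM hgcd
  refine ⟨γ ^ b, hγ.pow_of_coprime b hb, ?_⟩
  rw [← pow_mul, ← hc, pow_eq_pow_mod (b * a) hγ.pow_eq_one, hbac, ← pow_eq_pow_mod c hγ.pow_eq_one]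

/-! ## §3 The transport `χ : μ_M(Ω₀) ⥲ μ_M(Ω₁)` extending `ev₀ u ↦ ev₁ u` -/

/-- **TRANSPORT OF ROOTS OF UNITY ALONG TWO RIGID EVALUATIONS.**  Let `ev₀ : R → Ω₀`, `ev₁ : R → Ω₁` be ring homomorphisms into
algebraically closed fields with `M` invertible, rigid on `M`-th roots of unity (`u^M = 1 → evᵢ u = 1 → u = 1`; ★
`RootOfUnityRigidConnected` when `R = Γ(S′₀, 𝒪)` of a connected scheme and `evᵢ` are geometric points).  Then there is
`χ : Ω₀ → Ω₁` with (1) `χ` carries primitive `M`-th roots to primitive `M`-th roots, (2) `χ (z^e) = (χ z)^e` for `z^M = 1`, and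
(3) `χ (ev₀ u) = ev₁ u` for every `u ∈ R` with `u^M = 1`.  (The `M`-th roots of unity of `R` form a finite cyclic group embedded by
`ev₀` and `ev₁` — [Serre1973] Ch. I §1.2, Mathlib `isCyclic_of_injective_ringHom` —; match a generator on both sides by §2.)  The
(W3) transport of [Lan2013PELCompactifications] Lemma 1.3.6.6 reads the Weil-pairing values of a universal level-`M` basis through
such a `χ`. [cite: Lan2013PELCompactifications, §1.3.6 Lemma 1.3.6.6 and Cor. 1.3.6.7 (pp. 81–82)] [cite: Serre1973, Ch. I §1.2 Thm. 2] -/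
theorem exists_rootsOfUnity_transport {R Ω₀ Ω₁ : Type*} [CommRing R] [Field Ω₀] [Field Ω₁] [IsAlgClosed Ω₀] [IsAlgClosed Ω₁]
    {M : ℕ} [NeZero M] (hM₀ : (M : Ω₀) ≠ 0) (hM₁ : (M : Ω₁) ≠ 0) (ev₀ : R →+* Ω₀) (ev₁ : R →+* Ω₁)
    (hrig₀ : ∀ u : R, u ^ M = 1 → ev₀ u = 1 → u = 1) (hrig₁ : ∀ u : R, u ^ M = 1 → ev₁ u = 1 → u = 1) :
    ∃ χ : Ω₀ → Ω₁, (∀ z : Ω₀, IsPrimitiveRoot z M → IsPrimitiveRoot (χ z) M) ∧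
      (∀ z : Ω₀, z ^ M = 1 → ∀ e : ℕ, χ (z ^ e) = χ z ^ e) ∧
      ∀ u : R, u ^ M = 1 → χ (ev₀ u) = ev₁ u := by
  classical
  have hM : M ≠ 0 := NeZero.ne M
  haveI : NeZero (M : Ω₀) := ⟨hM₀⟩
  haveI : NeZero (M : Ω₁) := ⟨hM₁⟩
  obtain ⟨ω₀, hω₀⟩ := HasEnoughRootsOfUnity.exists_primitiveRoot Ω₀ M
  obtain ⟨γ, hγ⟩ := HasEnoughRootsOfUnity.exists_primitiveRoot Ω₁ M
  -- the `M`-th roots of unity of `R`, embedded in `Ω₀` and `Ω₁`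
  let G := rootsOfUnity M R
  let f₀ : G →* Ω₀ := ev₀.toMonoidHom.comp ((Units.coeHom R).comp G.subtype)
  let f₁ : G →* Ω₁ := ev₁.toMonoidHom.comp ((Units.coeHom R).comp G.subtype)
  have hf₀ : ∀ g : G, f₀ g = ev₀ ((g : Rˣ) : R) := fun _ => rfl
  have hf₁ : ∀ g : G, f₁ g = ev₁ ((g : Rˣ) : R) := fun _ => rfl
  have hGpow : ∀ g : G, (((g : Rˣ) : R)) ^ M = 1 := fun g => by
    rw [← Units.val_pow_eq_pow_val, show ((g : Rˣ)) ^ M = 1 from g.2, Units.val_one]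
  have hf₀inj : Function.Injective f₀ := by
    intro g g' hgg'
    change ev₀ ((g : Rˣ) : R) = ev₀ ((g' : Rˣ) : R) at hgg'
    have hq : (((g * g'⁻¹ : G) : Rˣ) : R) = 1 := by
      apply hrig₀ _ (hGpow _)
      rw [Subgroup.coe_mul, Subgroup.coe_inv, Units.val_mul, map_mul, hgg', ← map_mul, Units.mul_inv, map_one]
    exact mul_inv_eq_one.1 (Subtype.ext (Units.ext hq))
  have hf₁inj : Function.Injective f₁ := by
    intro g g' hgg'
    change ev₁ ((g : Rˣ) : R) = ev₁ ((g' : Rˣ) : R) at hgg'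
    have hq : (((g * g'⁻¹ : G) : Rˣ) : R) = 1 := by
      apply hrig₁ _ (hGpow _)
      rw [Subgroup.coe_mul, Subgroup.coe_inv, Units.val_mul, map_mul, hgg', ← map_mul, Units.mul_inv, map_one]
    exact mul_inv_eq_one.1 (Subtype.ext (Units.ext hq))
  -- `G` is finite (it embeds in the roots of `X^M - 1` in `Ω₀`) and cyclic
  haveI : Finite G := by
    refine Finite.of_injective (fun g : G => (⟨f₀ g, ?_⟩ : (Polynomial.nthRootsFinset M (1 : Ω₀)))) ?_
    · rw [Polynomial.mem_nthRootsFinset (Nat.pos_of_ne_zero hM), hf₀, ← map_pow, hGpow, map_one]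
    · intro g g' h
      exact hf₀inj (congrArg Subtype.val h :)
  haveI : IsCyclic G := isCyclic_of_injective_ringHom f₀ hf₀inj
  obtain ⟨g₀, hg₀⟩ := IsCyclic.exists_generator (α := G)
  -- `ev₀ g₀ = ω₀^a`, and `ev₁ g₀ = ω₁^a` for a primitive `ω₁`
  have hg₀M : (f₀ g₀) ^ M = 1 := by rw [hf₀, ← map_pow, hGpow, map_one]
  obtain ⟨a, -, ha⟩ := hω₀.eq_pow_of_pow_eq_one hg₀M
  have hg₀M' : (f₁ g₀) ^ M = 1 := by rw [hf₁, ← map_pow, hGpow, map_one]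
  have hord : orderOf (f₁ g₀) = orderOf (ω₀ ^ a) := by
    rw [ha, orderOf_injective f₁ hf₁inj g₀, orderOf_injective f₀ hf₀inj g₀]
  obtain ⟨ω₁, hω₁, hω₁a⟩ := exists_isPrimitiveRoot_pow_eq_of_orderOf_eq hγ hω₀ a hg₀M' hord
  -- the transport: `χ(ω₀^j) := ω₁^j`
  have hkey : ∀ {i j : ℕ}, ω₀ ^ i = ω₀ ^ j → ω₁ ^ i = ω₁ ^ j := by
    intro i j hij
    rw [pow_eq_pow_mod i hω₀.pow_eq_one, pow_eq_pow_mod j hω₀.pow_eq_one] at hij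
    rw [pow_eq_pow_mod i hω₁.pow_eq_one, pow_eq_pow_mod j hω₁.pow_eq_one,
      hω₀.pow_inj (Nat.mod_lt _ (Nat.pos_of_ne_zero hM)) (Nat.mod_lt _ (Nat.pos_of_ne_zero hM)) hij]
  let χ : Ω₀ → Ω₁ := fun z => if hz : z ^ M = 1 then ω₁ ^ Classical.choose (hω₀.eq_pow_of_pow_eq_one hz) else 0
  have hχ : ∀ j : ℕ, χ (ω₀ ^ j) = ω₁ ^ j := by
    intro j
    have hz : (ω₀ ^ j) ^ M = 1 := by rw [← pow_mul, mul_comm, pow_mul, hω₀.pow_eq_one, one_pow]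
    simp only [χ, dif_pos hz]
    exact hkey (Classical.choose_spec (hω₀.eq_pow_of_pow_eq_one hz)).2
  refine ⟨χ, fun z hz => ?_, fun z hz e => ?_, fun u hu => ?_⟩
  · -- primitive ↦ primitive
    obtain ⟨j, -, rfl⟩ := hω₀.eq_pow_of_pow_eq_one hz.pow_eq_one
    rw [hχ]
    exact hω₁.pow_of_coprime j ((hω₀.pow_iff_coprime (Nat.pos_of_ne_zero hM) j).1 hz)
  · -- `χ(z^e) = χ(z)^e`
    obtain ⟨j, -, rfl⟩ := hω₀.eq_pow_of_pow_eq_one hz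
    rw [← pow_mul, hχ, hχ, pow_mul]
  · -- compatibility with `ev₀ ↦ ev₁` on `μ_M(R)`
    have hu' : IsUnit u := IsUnit.of_pow_eq_one hu hM
    let g : G := ⟨hu'.unit, show hu'.unit ^ M = 1 from Units.ext (by
      rw [Units.val_pow_eq_pow_val, IsUnit.unit_spec, hu, Units.val_one])⟩
    have hgu : ((g : Rˣ) : R) = u := IsUnit.unit_spec hu'
    obtain ⟨t, ht⟩ := (mem_powers_iff_mem_zpowers.2 (hg₀ g))
    have h0 : ev₀ u = ω₀ ^ (a * t) := by
      rw [← hgu, ← hf₀, ← ht, map_pow, ← ha, ← pow_mul]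
    have h1 : ev₁ u = ω₁ ^ (a * t) := by
      rw [← hgu, ← hf₁, ← ht, map_pow, ← hω₁a, ← pow_mul]
    rw [h0, h1, hχ]

end Literature.GroupTheory.FiniteAbelian
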